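import Summits.CriticalPhenomena.PercolationContinuityZ3.Theorems.PercNearOneGluingNoHeavyQuantGatedSliceMixLawQHGiantTop
import Summits.CriticalPhenomena.PercolationContinuityZ3.Theorems.PercNearOneGluingNoHeavyQuantGatedSliceMixLawQ4TopMid
import Summits.CriticalPhenomena.PercolationContinuityZ3.Theorems.PercNearOneGluingNoHeavyQuantGatedSliceMixLawQTwinGiant
import Summits.CriticalPhenomena.PercolationContinuityZ3.Theorems.PercNearOneGluingNoHeavyQuantGatedSliceMixLawCellsEasy
import HarnessLib

/-!
# QUANT lane R8, T-DEC, leg (III), blob case — node `LawDec.GatedSliceMixLaw'`: CELL QH REDUCES TO CELL QK (`MixLawCellQK → MixLawCellQH`),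
# so — with `…QuantGatedSliceMixLawQCellQ4OfQK` — the node is CELL QK ALONE

builds on p205010 (kernel theorem, internal audit signed; external expert review pending)

Support file (`--supports stmt-CriticalPhenomena-4575`), QUANT lane, LEAD seat prim-quant-lead (gen 36), rung R8 of
`run/shared/lean/prim/quant/LADDER.md`.  Theorems only, standard axioms, no sorries, no definitions.  Companion of `…QuantGatedSliceMixLawQCellQ4OfQK`
(`mixLawCellQ4_of_QK`).

THE POINT.  Cell QH of `…QuantGatedSliceMixLawCells` (typer g30) is the frame of the node plus ONE inequality, `2S < t` (`t = S + ag(1−z)`: the blob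
dominates the mean).  That inequality forces `t < 2ag(1−z) ≤ 2a`, so the twin `k₁ + a` (indeed every atom `≥ a`) is NEVER a `t`-low, and the cell falls
apart along the status of the top `k₂` into pieces that are ALREADY kernel theorems of arm-1 g41 / the typer, plus cell QK:
no giant (`k₂ + a ≤ j`) ⟹ Theorem A (`mixLawQ_decAtT_of_top_le`); twin a giant ⟹ `mixLawQ_decAtT_of_twinGiant`; `k₁` not a `t`-low ⟹ cell Q2
(`mixLawCellQ2_holds`); `k₁` a `t`-low and the top a MID ⟹ `mixLawQ_decAtT_cellQ4_topMid`; the top a GIANT ⟹ `mixLawQ_decAtT_qh_giantTop` (`k₁ ≥ 1`) or the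
moment criterion `mixLawQ_decAtT_of_noLow` (`k₁ = 0`: no nonzero low at all); the top a `t`-LOW ⟹ cell QK verbatim.

* **`LawDec.mixLawCellQH_of_QK : MixLawCellQK → MixLawCellQH`.**
With `mixLawCellQ4_of_QK` and census-2 g61's `gatedSliceMixLaw'_of_Qcells` (p369789) the node `GatedSliceMixLaw'` — hence CW (`WindowMixDEC`) — follows from
`MixLawCellQK` alone (arm-1 g41's cell; its assembly `mixLawCellQK_holds` exists in that seat's folder, all its pieces incl. `qk_Ib_lh` are in the tree:
WAKE-arm-1-g36-QCELLS.md).  HONEST STATUS: `MixLawCellQK` (hence `GatedSliceMixLaw'`, CW), `GateMove`, `SingleGateConvClosed`, `TreeDEC`, `FarTreeRow` OPEN;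
RATE class log\* / honest sentence unchanged.

[this work]; cells: prim-quant-stmt g30; class theorems: prim-quant-arm-1 g41; Q2: `…CellsEasy` (this lane).  The gluing rows served
[cite: KozmaNitzan2024, Conjecture 3 (p. 15)]; product measure [cite: Grimmett1999, §1.3 p. 10].
-/

noncomputable section

namespace Summit.CriticalPhenomena.PercolationContinuityZ3.Theorems

namespace Quant

open Finset

namespace LawDec

/-- **Cell QH follows from cell QK.**  Under `2S < t` one has `t < 2a`, so the twin `k₁ + a` is a mid; then cases on the top `k₂`:
no giant / twin giant / `k₁` not low / top mid / top giant (`k₁ ≥ 1` or `k₁ = 0`) / top low (= cell QK). [this work] -/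
theorem mixLawCellQH_of_QK (hQK : MixLawCellQK) : MixLawCellQH := by
  intro y z g S lam a j M k₁ k₂ hy0 hy1 hz0 hz1 hg1 hyg ha hjM hS0 hta hSj hSM hk hk₂M hlam0 hlam1 hmean hQH
  -- derived facts: `0 < g`, `t < 2a`, the twin is a mid
  have h1z : 0 < 1 - z := by linarith
  have hg0 : 0 < g := by nlinarith
  have ha0 : (0 : ℝ) ≤ a := Nat.cast_nonneg a
  have hag : (a : ℝ) * g * (1 - z) ≤ a := by
    have h1 : g * (1 - z) ≤ 1 := by nlinarith
    nlinarith
  have ht2a : S + (a : ℝ) * g * (1 - z) < 2 * (a : ℝ) := by linarith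
  have hk₁0 : (0 : ℝ) ≤ k₁ := Nat.cast_nonneg k₁
  have hPmid : S + (a : ℝ) * g * (1 - z) ≤ 2 * ((k₁ + a : ℕ) : ℝ) := by
    push_cast; linarith
  by_cases hGle : k₂ + a ≤ j
  · -- no giant: Theorem A at the moved law's own mean
    have h := mixLawQ_decAtT_of_top_le y z g lam a j M k₁ k₂ hy0.le hy1 hz0 hz1.le hg0.le hg1 hyg hk hk₂M hlam0 hlam1
      (by rw [hmean]; exact hta) hGle
    have ht : (1 - z) * ((k₁ : ℝ) + ((k₂ : ℝ) - k₁) * lam) + (a : ℝ) * g - z * (a : ℝ) * g = S + (a : ℝ) * g * (1 - z) := by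
      rw [hmean]; ring
    rw [ht] at h
    exact h
  · have hG : j + 1 ≤ k₂ + a := by omega
    by_cases hPG : j + 1 ≤ k₁ + a
    · -- the twin is a giant
      exact mixLawQ_decAtT_of_twinGiant y z g S lam a j M k₁ k₂ hy0 hy1 hz0 hz1 hg1 hyg ha hjM hk hk₂M hlam0 hlam1 hPG
    · have hPj : k₁ + a ≤ j := by omega
      by_cases hlow : k₁ ≤ j ∧ 2 * (k₁ : ℝ) < S + (a : ℝ) * g * (1 - z)
      · obtain ⟨hk₁j, hk₁low⟩ := hlow
        by_cases hKj : k₂ ≤ j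
        · by_cases hKmid : S + (a : ℝ) * g * (1 - z) ≤ 2 * (k₂ : ℝ)
          · -- top a mid: arm-1's assembled cell-Q4 theorem
            exact mixLawQ_decAtT_cellQ4_topMid y z g S lam a j M k₁ k₂ hy0 hy1 hz0 hz1 hg1 hyg ha hta hk hk₂M hlam0 hlam1 hmean
              hk₁j hk₁low hPj hPmid hKj hKmid hG
          · -- top a `t`-low: cell QK
            exact hQK y z g S lam a j M k₁ k₂ hy0 hy1 hz0 hz1 hg1 hyg ha hjM hS0 hta hSj hSM hk hk₂M hlam0 hlam1 hmean hKj
              (not_le.1 hKmid)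
        · have hKG : j + 1 ≤ k₂ := by omega
          by_cases hk₁ : 1 ≤ k₁
          · -- top a giant, `k₁ ≥ 1`: arm-1's cell-QH theorem
            exact mixLawQ_decAtT_qh_giantTop y z g S lam a j M k₁ k₂ hy0 hy1 hz0 hz1 hg1 hyg ha hta hk hk₂M hlam0 hlam1 hmean
              hk₁ hk₁j hk₁low hPj hPmid hKG hQH
          · -- top a giant, `k₁ = 0`: no nonzero low at all (the twin `a` and everything above it are `> t/2`)
            have hk₁e : k₁ = 0 := by omega
            refine mixLawQ_decAtT_of_noLow y z g S lam a j M k₁ k₂ hy0 hy1 hz0 hz1 hg1 hyg ha hta hk hk₂M hlam0 hlam1 hmean ?_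
            intro l hl1 hlj hllow
            rw [movedTwoPoint_apply]
            have hla : l < a := by
              have : (l : ℝ) < a := by linarith
              exact_mod_cast this
            rw [if_neg (by omega), if_neg (by omega), if_neg (by omega), if_neg (by omega), if_neg (by omega)]
            ring
      · -- `k₁` is not a `t`-low: cell Q2 (the typer's `mixLawCellQ2_holds`)
        exact mixLawCellQ2_holds y z g S lam a j M k₁ k₂ hy0 hy1 hz0 hz1 hg1 hyg ha hjM hS0 hta hSj hSM hk hk₂M hlam0 hlam1
          hmean hlow

end LawDec

end Quant

end Summit.CriticalPhenomena.PercolationContinuityZ3.Theorems
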